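import Literature.NumberTheory.EllipticCurves.Sprung2024.ChromaticSmallControlProofs
import HarnessLib

/-!
# The order of `ker g = A⋆_0/Sel_0` DIVIDES `∏_{v ∈ S} #𝒦_{v,0}[p^∞]` — Greenberg's localisation of the
# control diagram at `n = 0` as an exact divisibility (the half of Sprung 2024 Lemma 5.5 that needs no
# Poitou–Tate duality)

`Proofs` file (theorems only: **no definition, no named fact**; axioms standard), sequel of
`Sprung2024/ChromaticSmallControlProofs.lean` §3 (cell `bsd-ssimc`, seat `bsd-ssimc-k3c5-kdot-split`
g5: `WeierstrassCurve.finite_quotient_selmerLayer_zero_of_localResOver_eq_zero`, FINITENESS of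
`A'/Sel_0` from Greenberg's Lemma 3.3). The same evaluation map, corestricted, gives the COUNT one
actually needs for the lower (Eisenstein) half of the ♯/♭ Euler characteristic:

R. Greenberg, *Iwasawa theory for elliptic curves*, LNM 1716 (1999), §4 p. 104: "Now let
`𝒢_E^Σ(F) = Im(H¹(F_Σ/F, E[p^∞]) → 𝒫_E^Σ(F))` … Then `ker(g) = ker(r) ∩ 𝒢_E^Σ(F)`", with
`|ker(r)| = ∏_v |ker(r_v)|` (p. 104) and, p. 88, "`|ker(r_v)| = c_v^{(p)}`" at the bad `v ∤ p`,
`ker(r_v) = 0` at the good `v ∤ p` (Lemma 3.3). Hence **`|ker(g)|` divides `∏_{v bad, v ∤ p} |ker(r_v)|`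
as soon as `ker(r_v) = 0` at the places above `p`** — no Cassels–Poitou–Tate (that theorem, p. 104,
is what turns the inclusion into Greenberg's EQUALITY Lemma 4.7). F. Sprung, Adv. Math. 449 (2024)
§5.2 p. 40 runs the same diagram for `Sel⋆` with "`r_p` is injective" (Lemma 5.5, case `v = p`).

In the tree's rendering (`IwasawaSelmerControl*`: `ker g_0 = A_0/Sel_0`, `A_0 = h_0⁻¹(Sel_∞)`,
`ker(r_v)[p^∞] = 𝒦_{v,0}[p^∞] = W.localTowerKerPrimary κ (K_v) 0`):

* `WeierstrassCurve.natCard_quotient_selmerLayer_zero_dvd_prod_natCard_localTowerKerPrimary` — for an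
  elliptic curve over a number field `K`, ANY `ℤ_p`-extension `κ`, any `A' ⊆ A_0` whose classes
  satisfy the classical local condition at the places above `p`, and any finite set `S` of places
  containing every bad place not above `p`:
  **`#(A'/Sel_0) ∣ ∏_{v ∈ S} #𝒦_{v,0}[p^∞]`** (the evaluation map `A' → ∏_{v∈S} 𝒦_{v,0}[p^∞]` has
  kernel inside `Sel_0`: g5's argument; then Lagrange);
* `Sprung2024.natCard_sharpFlatKerG_dvd_prod_natCard_localTowerKerPrimary` — over `ℚ`, for the
  chromatic group `A⋆_0 = h_0⁻¹(Sel⋆(E/ℚ_∞))` with the `v = p` input in the shape of the body of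
  `lem55AllN_sharpFlat_localKerOver_of_layerToInfty_mem` ("`r_p` is injective"):
  **`#(A⋆_0/Sel_0) ∣ ∏_{v ∈ S} #𝒦_{v,0}[p^∞]`**.

With the tree's kernel count `#𝒦_{v,0}[p^∞] = p^{ord_p c_v}` (Greenberg p. 88; class-closure lane,
`Summit.BirchSwinnertonDyer.Rank1Residual.Additive.natCard_localTowerKerPrimary_zero_eq_pow_of_isCyclotomic`)
this yields `#ker g ∣ ∏_l c_l` Summits-side, hence — with Lemmas 5.8 · 5.9 of
`ChromaticEulerCharAssemblyProofs` — the INEQUALITY `ord_p f⋆(0) ≤ ord_p ∏ c_l + ord_p #Sel_{p^∞}(E/ℚ)`,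
which is all that the Eisenstein half of the ♯/♭ main conjecture consumes (route K3 of cell `bsd-ssimc`,
crux 5 `SprungLowerHalfAtThree`). HONEST FRAMING: kernel theorems about the tree's objects; nothing
about any curve is asserted; no census cell moves; BSD is not proved by any of this.

## References
* [GreenbergLNM1716] §3 Lemma 3.3 and p. 88; §4 p. 104 (`ker(g) = ker(r) ∩ 𝒢`, `|ker(r)| = ∏|ker(r_v)|`).
* [Sprung2024] §5.2 proof of Lemma 5.5 (p. 40).
-/

noncomputable section

open scoped Classical NumberField

open NumberField IsDedekindDomain

universe u

/-! ## §1 Generic: `#(A'/Sel_0) ∣ ∏_{v ∈ S} #𝒦_{v,0}[p^∞]` -/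

namespace WeierstrassCurve

open Literature.NumberTheory.EllipticCurves Literature.NumberTheory.GaloisRepresentations

variable {K : Type u} [Field K] [NumberField K] (W : WeierstrassCurve K) {p : ℕ} [Fact p.Prime]
  (κ : ZpExtension K p)

/-- **`#(A'/Sel_0)` divides `∏_{v ∈ S} #𝒦_{v,0}[p^∞]`** for every `A' ⊆ A_0 = h_0⁻¹(Sel_{p^∞}(E/K_∞))`
whose classes satisfy the classical local condition at the places above `p`, and every finite set `S`
of finite places outside which every place not above `p` is good (Greenberg, LNM 1716, p. 104:
"`ker(g) = ker(r) ∩ 𝒢_E^Σ(F)`", `|ker(r)| = ∏_v |ker(r_v)|`; Lemma 3.3: `ker(r_v) = 0` at the good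
`v ∤ p`). Proof: the evaluation map `Φ : A' → ∏_{v ∈ S} 𝒦_{v,0}[p^∞]` (values in the local tower
kernels by `localResOver_conjH1_mem_localTowerKer_of_mem`, `p`-power torsion) has `ker Φ ⊆ Sel_0`
(at good `v ∤ p` outside `S`: `localTowerKerPrimary_zero_eq_bot_of_hasGoodReductionAt`; archimedean
places split; above `p`: the hypothesis) — g5's argument in `finite_quotient_selmerLayer_zero_of_localResOver_eq_zero` —
so `A'/Sel_0` is a quotient of `A'/ker Φ ≅ im Φ ≤ ∏ 𝒦_{v,0}[p^∞]` (Lagrange). An identity of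
`Nat.card`s; no finiteness needed. [cite: GreenbergLNM1716, §4 p. 104 and §3 Lemma 3.3 (pp. 86–88)]
[cite: Sprung2024, §5.2 proof of Lemma 5.5 (p. 40)] -/
theorem natCard_quotient_selmerLayer_zero_dvd_prod_natCard_localTowerKerPrimary [W.IsElliptic]
    (A' : AddSubgroup (W.subgroupH1 p (κ.layerSubgroup 0)))
    (hA' : A' ≤ W.selmerInftyPreimage κ 0)
    (hp : ∀ v : HeightOneSpectrum (𝓞 K), (p : 𝓞 K) ∈ v.asIdeal → ∀ y ∈ A',
      W.localResOver p (κ.layerSubgroup 0) (v.adicCompletion K) y = 0)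
    (S : Finset (HeightOneSpectrum (𝓞 K)))
    (hS : ∀ v : HeightOneSpectrum (𝓞 K), v ∉ S → (p : 𝓞 K) ∉ v.asIdeal → W.HasGoodReductionAt v) :
    Nat.card (↥A' ⧸ (W.selmerLayer κ 0).addSubgroupOf A') ∣
      ∏ v ∈ S, Nat.card (W.localTowerKerPrimary κ (v.adicCompletion K) 0) := by
  -- at layer `0` every `conj_σ` is the identity (`Gal(K̄/K_0) = Γ_K`)
  have hconj : ∀ (σ : Field.absoluteGaloisGroup K) (y : W.subgroupH1 p (κ.layerSubgroup 0)),
      W.conjH1 p (κ.layerSubgroup 0) σ y = y := fun σ y ↦ by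
    rw [W.conjH1_of_mem_holds p (κ.layerSubgroup 0)
      (show σ ∈ κ.layerSubgroup 0 by rw [ZpExtension.layerSubgroup_zero]; trivial),
      AddMonoidHom.id_apply]
  -- for `y ∈ A' ⊆ A_0`, `loc_v y ∈ 𝒦_{v,0}[p^∞]` at every finite place
  have hprimary : ∀ (y : ↥A') (v : HeightOneSpectrum (𝓞 K)),
      W.localResOver p (κ.layerSubgroup 0) (v.adicCompletion K) (y : W.subgroupH1 p _) ∈
        W.localTowerKerPrimary κ (v.adicCompletion K) 0 := by
    intro y v
    obtain ⟨k, hk⟩ := W.exists_pow_smul_subgroupH1_layer_eq_zero κ 0 (y : W.subgroupH1 p _)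
    have hmem := W.localResOver_conjH1_mem_localTowerKer_of_mem κ (hA' y.2) v 1
    rw [hconj] at hmem
    exact ⟨hmem, k, by rw [← map_nsmul, hk, map_zero]⟩
  -- the evaluation map `Φ y = (loc_v y)_{v ∈ S}`, corestricted to the local tower kernels
  let Φ : ↥A' →+ (Π v : ↥S, ↥(W.localTowerKerPrimary κ (v.1.adicCompletion K) 0)) :=
    AddMonoidHom.pi fun v ↦
      ((W.localResOver p (κ.layerSubgroup 0) (v.1.adicCompletion K)).comp A'.subtype).codRestrict
        (W.localTowerKerPrimary κ (v.1.adicCompletion K) 0) fun y ↦ hprimary y v.1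
  have hΦ : ∀ (y : ↥A') (v : ↥S), ((Φ y v : ↥(W.localTowerKerPrimary κ (v.1.adicCompletion K) 0)) :
      discreteH1 (localSubgroup (κ.layerSubgroup 0) (v.1.adicCompletion K))
        (localPoints W (v.1.adicCompletion K))) =
      W.localResOver p (κ.layerSubgroup 0) (v.1.adicCompletion K) (y : W.subgroupH1 p _) :=
    fun y v ↦ rfl
  -- `ker Φ ⊆ Sel_0`
  have hker : Φ.ker ≤ (W.selmerLayer κ 0).addSubgroupOf A' := by
    intro y hy
    rw [AddSubgroup.mem_addSubgroupOf]
    change (y : W.subgroupH1 p (κ.layerSubgroup 0)) ∈ W.selmerGroupOver p (κ.layerSubgroup 0)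
    rw [mem_selmerGroupOver_iff]
    refine ⟨fun v σ ↦ ?_, fun w σ ↦ ?_⟩
    · rw [hconj, mem_localKerOver_iff]
      by_cases hpv : (p : 𝓞 K) ∈ v.asIdeal
      · exact hp v hpv _ y.2
      · by_cases hvS : v ∈ S
        · have h0 : Φ y ⟨v, hvS⟩ = 0 := by
            have := congrFun (congrArg (fun f ↦ (f : Π v : ↥S, _)) ((AddMonoidHom.mem_ker).mp hy))
              ⟨v, hvS⟩
            exact this
          have := congrArg (fun z : ↥(W.localTowerKerPrimary κ (v.adicCompletion K) 0) ↦
            (z : discreteH1 (localSubgroup (κ.layerSubgroup 0) (v.adicCompletion K))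
              (localPoints W (v.adicCompletion K)))) h0
          rw [hΦ y ⟨v, hvS⟩] at this
          exact this
        · have hgood := hS v hvS hpv
          have hmem := hprimary y v
          rw [W.localTowerKerPrimary_zero_eq_bot_of_hasGoodReductionAt κ v hpv hgood,
            AddSubgroup.mem_bot] at hmem
          exact hmem
    · rw [hconj, mem_localKerOver_iff]
      have hmem := W.localResOver_conjH1_mem_localTowerKer_of_mem_infinitePlace κ (hA' y.2) w 1
      rw [hconj, W.localTowerKer_eq_bot_of_forall_mem κ w.Completion 0
        (κ.resGal_infinitePlace_mem_kerSubgroup w), AddSubgroup.mem_bot] at hmem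
      exact hmem
  -- `#(A'/Sel_0) ∣ #(A'/ker Φ)` (third isomorphism theorem)
  have h1 : Nat.card (↥A' ⧸ (W.selmerLayer κ 0).addSubgroupOf A') ∣ Nat.card (↥A' ⧸ Φ.ker) := by
    refine Dvd.intro (Nat.card (((W.selmerLayer κ 0).addSubgroupOf A').map
      (QuotientAddGroup.mk' Φ.ker))) ?_
    rw [← Nat.card_congr (QuotientAddGroup.quotientQuotientEquivQuotient Φ.ker
      ((W.selmerLayer κ 0).addSubgroupOf A') hker).toEquiv]
    exact (AddSubgroup.card_eq_card_quotient_mul_card_addSubgroup _).symm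
  -- `#(A'/ker Φ) = #im Φ ∣ #∏_{v ∈ S} 𝒦_{v,0}[p^∞]` (Lagrange)
  have h2 : Nat.card (↥A' ⧸ Φ.ker) ∣
      Nat.card (Π v : ↥S, ↥(W.localTowerKerPrimary κ (v.1.adicCompletion K) 0)) := by
    rw [Nat.card_congr (QuotientAddGroup.quotientKerEquivRange Φ).toEquiv]
    exact Φ.range.card_addSubgroup_dvd_card
  rw [Nat.card_pi] at h2
  rw [← Finset.prod_coe_sort S]
  exact h1.trans h2

end WeierstrassCurve

/-! ## §2 Over `ℚ`, for the chromatic group `A⋆_0 = h_0⁻¹(Sel⋆(E/ℚ_∞))` -/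

namespace Literature.NumberTheory.EllipticCurves.Sprung2024

open Literature.NumberTheory.EllipticCurves Literature.NumberTheory.GaloisRepresentations WeierstrassCurve
  ZpExtension Literature.NumberTheory.EllipticCurves.Sprung2017 Literature.NumberTheory.EllipticCurves.Sprung2012

/-- Places of `ℚ` containing the same rational prime coincide (`𝓞 ℚ ≃ ℤ`). [folklore] -/
private theorem heightOneSpectrum_rat_eq_of_natCast_mem'' {ℓ : ℕ} (hℓ : ℓ.Prime)
    {v v' : HeightOneSpectrum (𝓞 ℚ)} (hv : (ℓ : 𝓞 ℚ) ∈ v.asIdeal)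
    (hv' : (ℓ : 𝓞 ℚ) ∈ v'.asIdeal) : v = v' := by
  have hprime : Prime (ℓ : 𝓞 ℚ) := by
    rw [← MulEquiv.prime_iff (Rat.ringOfIntegersEquiv : 𝓞 ℚ ≃+* ℤ).toMulEquiv]
    change Prime (Rat.ringOfIntegersEquiv (ℓ : 𝓞 ℚ))
    rw [map_natCast, ← Nat.prime_iff_prime_int]
    exact hℓ
  have hmax : (Ideal.span {(ℓ : 𝓞 ℚ)}).IsMaximal :=
    ((Ideal.span_singleton_prime hprime.ne_zero).mpr hprime).isMaximal
      (by rw [Ne, Ideal.span_singleton_eq_bot]; exact hprime.ne_zero)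
  have key : ∀ u : HeightOneSpectrum (𝓞 ℚ), (ℓ : 𝓞 ℚ) ∈ u.asIdeal →
      Ideal.span {(ℓ : 𝓞 ℚ)} = u.asIdeal := fun u hu ↦
    hmax.eq_of_le u.isPrime.ne_top ((Ideal.span_singleton_le_iff_mem _).mpr hu)
  exact HeightOneSpectrum.ext (by rw [← key v hv, key v' hv'])

/-- **`#ker g = #(A⋆_0/Sel_0)` divides `∏_{v ∈ S} #𝒦_{v,0}[p^∞]`** for Sprung's chromatic Selmer group
over `ℚ`: `W/ℚ` elliptic, any `ℤ_p`-extension `κ`, the place `v ∋ p` with the chosen embedding, data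
`(g, c, ⋆)`, `A⋆_0 = h_0⁻¹(Sel⋆(E/ℚ_∞))`, `S` any finite set of places outside which every place
`≠ p` is good, PROVIDED "`r_p` is injective" in the shape of the body of
`lem55AllN_sharpFlat_localKerOver_of_layerToInfty_mem` (`hloc`: a class whose restriction satisfies the
`⋆`-condition at `𝔭` is classically Selmer at `p`). Greenberg p. 104 (`ker(g) = ker(r) ∩ 𝒢`) /
Sprung 2024 p. 40 with `Sel ↦ Sel⋆`; the divisibility half of Lemma 5.5, free of Poitou–Tate.
[cite: Sprung2024, §5.2 proof of Lemma 5.5 (p. 40)] [cite: GreenbergLNM1716, §4 p. 104 and §3 Lemma 3.3] -/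
theorem natCard_sharpFlatKerG_dvd_prod_natCard_localTowerKerPrimary
    (W : WeierstrassCurve ℚ) [W.IsElliptic] [W.IsGloballyMinimal] (p : ℕ) [Fact p.Prime]
    (κ : ZpExtension ℚ p) (v : HeightOneSpectrum (𝓞 ℚ)) (hv : (p : 𝓞 ℚ) ∈ v.asIdeal)
    (g : Field.absoluteGaloisGroup (v.adicCompletion ℚ))
    (c : ℕ → localPoints W (v.adicCompletion ℚ)) (col : Chroma)
    (hloc : ∀ y : W.subgroupH1 p (κ.layerSubgroup 0),
      W.layerToInfty κ 0 y ∈ sharpFlatLocalKummerOverOfEmb W p κ.kerSubgroup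
          (closureEmb (K := ℚ) (v.adicCompletion ℚ))
          (localTowerPointsOfEmb κ (closureEmb (K := ℚ) (v.adicCompletion ℚ)) W)
          (colemanKer κ (closureEmb (K := ℚ) (v.adicCompletion ℚ)) W (W.frobeniusTrace p) g c col) →
        y ∈ W.localKerOver p (κ.layerSubgroup 0) (v.adicCompletion ℚ))
    (S : Finset (HeightOneSpectrum (𝓞 ℚ)))
    (hS : ∀ v' : HeightOneSpectrum (𝓞 ℚ), v' ∉ S → (p : 𝓞 ℚ) ∉ v'.asIdeal → W.HasGoodReductionAt v') :
    Nat.card (↥((sharpFlatSelmerInfty W κ (closureEmb (K := ℚ) (v.adicCompletion ℚ))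
        (W.frobeniusTrace p) g c col).comap (W.layerToInfty κ 0)) ⧸
      (W.selmerLayer κ 0).addSubgroupOf
        ((sharpFlatSelmerInfty W κ (closureEmb (K := ℚ) (v.adicCompletion ℚ))
          (W.frobeniusTrace p) g c col).comap (W.layerToInfty κ 0))) ∣
      ∏ v' ∈ S, Nat.card (W.localTowerKerPrimary κ (v'.adicCompletion ℚ) 0) := by
  refine W.natCard_quotient_selmerLayer_zero_dvd_prod_natCard_localTowerKerPrimary κ _
    (comap_layerToInfty_sharpFlatSelmerInfty_le_selmerInftyPreimage W κ
      (closureEmb (K := ℚ) (v.adicCompletion ℚ)) (W.frobeniusTrace p) g c col) (fun v' hv' y hy ↦ ?_)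
    S hS
  obtain rfl : v = v' := heightOneSpectrum_rat_eq_of_natCast_mem'' (Fact.out : p.Prime) hv hv'
  have h1 := ((mem_sharpFlatSelmerInfty_iff W κ (closureEmb (K := ℚ) (v.adicCompletion ℚ))
    (W.frobeniusTrace p) g c col _).mp (AddSubgroup.mem_comap.mp hy)).2 1
  rw [W.conjH1_one_holds p κ.kerSubgroup, AddMonoidHom.id_apply] at h1
  exact (W.mem_localKerOver_iff p (κ.layerSubgroup 0) (v.adicCompletion ℚ) y).mp (hloc y h1)

end Literature.NumberTheory.EllipticCurves.Sprung2024

end
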